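import Mathlib
import Summits.Ventures.PercRepro2.HCov
import Summits.Ventures.PercRepro2.HCovSwap
import Summits.Ventures.PercRepro2.OddsLemma
import Summits.Ventures.PercRepro2.RV
import Summits.Ventures.PercRepro2.CaseOneRV

/-!
# One (RV) statement of record: `J1RV.RV ⟺ CaseOne.RV`
(blind cell PercRepro2, typer-1 g9; lead g24 INBOX 23:57:39Z «ONE (RV) PROP, NOT TWO», ASSIGNMENTS v12.48)

p1's `CaseOne.RV` (CaseOneRV.lean) is the typing of row 2′J1-RV.  `J1RV.RV` (RV.lean, landed in the same
minute) is the same cleared expression written with the masses `pQ, pQb, pT1, …` and the events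
`avoidAll`, `PDEvent`, `CovForm.Do` instead of `(connEvent a₁ a₂)ᶜ`, `CaseOne.Tp`, `CaseOne.Dpd`, `CaseOne.Dpdo`.
This file proves they are literally the same numbers — `rvTableExpr = CaseOne.iiExpr`,
`rvExpr = CaseOne.rvExpr` — hence **`RV_iff : J1RV.RV ↔ CaseOne.RV`** and
**`RVTable_iff : J1RV.RVTable ↔ CaseOne.ZSplitII`**: every theorem of `RV.lean` / `SLevelRegime.lean`
(the regime corollaries, `(SC) ⟹ (ii)`, the `S`-level decomposition) applies verbatim to p1's statement
of record, and `J1RV.RV` is a proven alias, not a second statement.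

Vocabulary bridges: `CovForm.compl_connEvent_eq_Q` (`(connEvent a₁ a₂)ᶜ = avoidAll a₂ {a₁}`), `Tp_eq` (`T′`), `Dpd_eq`
(`D = P(PD)`), `Dpdo_eq` (`D_o = P(PD, o ∈ C₁) + P(PD, o ∈ C₂)`: on `Q` the two are disjoint).
-/

namespace Summit.Ventures.PercRepro2

open UnionCluster

namespace J1RV

section Bridge

variable {V : Type*} {E : Type*} [Fintype E] [DecidableEq E] {R : Type*} [Field R] [LinearOrder R]

omit [Fintype E] [DecidableEq E] [LinearOrder R] in
/-- `T′` in both spellings. -/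
lemma Tp_eq (ends : E → Sym2 V) (a₁ a₂ a₃ : V) :
    CaseOne.Tp ends a₁ a₂ a₃ = avoidAll ends a₂ {a₁} ∩ connEvent ends a₁ a₃ := by
  unfold CaseOne.Tp
  rw [CovForm.compl_connEvent_eq_Q]

omit [LinearOrder R] in
/-- `D = P(PD)`: p1's `Dpd` is the probability of `PDEvent`. -/
lemma Dpd_eq (p : E → R) (ends : E → Sym2 V) (a₁ a₂ a₃ : V) :
    CaseOne.Dpd p ends a₁ a₂ a₃ = prob p (PDEvent ends a₁ a₂ a₃) := by
  unfold CaseOne.Dpd PDEvent Dtilde inU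
  congr 1
  ext ω
  simp only [Set.mem_inter_iff, Set.mem_compl_iff, Set.mem_union, mem_connEvent]
  constructor
  · rintro ⟨⟨h1, h2⟩, h3⟩
    exact ⟨h3, fun h => h.elim (fun h => h1 (conn_symm h)) (fun h => h2 (conn_symm h))⟩
  · rintro ⟨h3, h12⟩
    exact ⟨⟨fun h => h12 (Or.inl (conn_symm h)), fun h => h12 (Or.inr (conn_symm h))⟩, h3⟩

omit [LinearOrder R] in
/-- `D_o = P(PD, o ∈ C₁ ∪ C₂) = P(PD, o ∈ C₁) + P(PD, o ∈ C₂)`: on `Q` the clusters of the two roots are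
disjoint, so the union is a disjoint union. -/
lemma Dpdo_eq (p : E → R) (ends : E → Sym2 V) (o a₁ a₂ a₃ : V) :
    CaseOne.Dpdo p ends o a₁ a₂ a₃ = CovForm.Do p ends o a₁ a₂ a₃ := by
  unfold CaseOne.Dpdo CovForm.Do
  set A := (connEvent ends a₁ a₃)ᶜ ∩ (connEvent ends a₂ a₃)ᶜ ∩ (connEvent ends a₁ a₂)ᶜ with hA
  have e0 : (connEvent ends a₁ o ∪ connEvent ends a₂ o) ∩ (connEvent ends a₁ a₃)ᶜ ∩
      (connEvent ends a₂ a₃)ᶜ ∩ (connEvent ends a₁ a₂)ᶜ =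
      (connEvent ends a₁ o ∩ A) ∪ (connEvent ends a₂ o ∩ A) := by
    rw [hA]; ext ω; simp only [Set.mem_inter_iff, Set.mem_union, Set.mem_compl_iff]; tauto
  have hdisj : Disjoint (connEvent ends a₁ o ∩ A) (connEvent ends a₂ o ∩ A) := by
    rw [Set.disjoint_left]
    rintro ω ⟨h1, ⟨_, _⟩, h3⟩ ⟨h2, _⟩
    exact h3 (conn_trans h1 (conn_symm h2))
  have e1 : PDEvent ends a₁ a₂ a₃ ∩ connEvent ends a₁ o = connEvent ends a₁ o ∩ A := by
    rw [hA]; unfold PDEvent Dtilde inU; ext ω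
    simp only [Set.mem_inter_iff, Set.mem_compl_iff, Set.mem_union, mem_connEvent]
    constructor
    · rintro ⟨⟨h3, h12⟩, ho⟩
      exact ⟨ho, ⟨fun h => h12 (Or.inl (conn_symm h)), fun h => h12 (Or.inr (conn_symm h))⟩, h3⟩
    · rintro ⟨ho, ⟨h1, h2⟩, h3⟩
      exact ⟨⟨h3, fun h => h.elim (fun h => h1 (conn_symm h)) (fun h => h2 (conn_symm h))⟩, ho⟩
  have e2 : PDEvent ends a₁ a₂ a₃ ∩ connEvent ends a₂ o = connEvent ends a₂ o ∩ A := by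
    rw [hA]; unfold PDEvent Dtilde inU; ext ω
    simp only [Set.mem_inter_iff, Set.mem_compl_iff, Set.mem_union, mem_connEvent]
    constructor
    · rintro ⟨⟨h3, h12⟩, ho⟩
      exact ⟨ho, ⟨fun h => h12 (Or.inl (conn_symm h)), fun h => h12 (Or.inr (conn_symm h))⟩, h3⟩
    · rintro ⟨ho, ⟨h1, h2⟩, h3⟩
      exact ⟨⟨h3, fun h => h.elim (fun h => h1 (conn_symm h)) (fun h => h2 (conn_symm h))⟩, ho⟩
  rw [e0, prob_union_of_disjoint p hdisj, e1, e2]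

omit [LinearOrder R] in
/-- **`rvTableExpr = CaseOne.iiExpr`**: the table form of (RV) in the two vocabularies is the same number. -/
theorem rvTableExpr_eq_iiExpr (p : E → R) (ends : E → Sym2 V) (o a₁ a₂ a₃ b : V) :
    rvTableExpr p ends o a₁ a₂ a₃ b = CaseOne.iiExpr p ends o a₁ a₂ a₃ b := by
  rw [CaseOne.iiExpr_eq_probs, Dpd_eq, Dpdo_eq, CovForm.compl_connEvent_eq_Q]
  unfold rvTableExpr pQ pQb pT1 pT1b pT1o pT1ob
  have s1 : connEvent ends a₂ b ∩ connEvent ends a₁ a₃ ∩ connEvent ends a₂ o ∩ avoidAll ends a₂ {a₁} =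
      avoidAll ends a₂ {a₁} ∩ connEvent ends a₁ a₃ ∩ connEvent ends a₂ o ∩ connEvent ends a₂ b := by
    ext ω; simp only [Set.mem_inter_iff]; tauto
  have s2 : connEvent ends a₂ b ∩ connEvent ends a₁ a₃ ∩ avoidAll ends a₂ {a₁} =
      avoidAll ends a₂ {a₁} ∩ connEvent ends a₁ a₃ ∩ connEvent ends a₂ b := by
    ext ω; simp only [Set.mem_inter_iff]; tauto
  have s3 : connEvent ends a₂ b ∩ avoidAll ends a₂ {a₁} = avoidAll ends a₂ {a₁} ∩ connEvent ends a₂ b :=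
    Set.inter_comm _ _
  have s4 : connEvent ends a₁ a₃ ∩ connEvent ends a₂ o ∩ avoidAll ends a₂ {a₁} =
      avoidAll ends a₂ {a₁} ∩ connEvent ends a₁ a₃ ∩ connEvent ends a₂ o := by
    ext ω; simp only [Set.mem_inter_iff]; tauto
  have s5 : connEvent ends a₁ a₃ ∩ avoidAll ends a₂ {a₁} = avoidAll ends a₂ {a₁} ∩ connEvent ends a₁ a₃ :=
    Set.inter_comm _ _
  rw [s1, s2, s3, s4, s5]

omit [LinearOrder R] in
/-- **`rvExpr = CaseOne.rvExpr`**: form (b) of (RV) in the two vocabularies is the same number. -/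
theorem rvExpr_eq_caseOne (p : E → R) (ends : E → Sym2 V) (o a₁ a₂ a₃ b : V) :
    rvExpr p ends o a₁ a₂ a₃ b = CaseOne.rvExpr p ends o a₁ a₂ a₃ b := by
  rw [rvExpr_eq, CaseOne.rvExpr_eq, rvTableExpr_eq_iiExpr, Tp_eq]
  rfl

/-- **One (RV): `J1RV.RV ↔ CaseOne.RV`** (the statement of record is p1's; this one is its alias). -/
theorem RV_iff (p : E → R) (ends : E → Sym2 V) (o a₁ a₂ a₃ b : V) :
    RV p ends o a₁ a₂ a₃ b ↔ CaseOne.RV p ends o a₁ a₂ a₃ b := by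
  unfold RV CaseOne.RV
  rw [rvExpr_eq_caseOne]

/-- **`J1RV.RVTable ↔ CaseOne.ZSplitII`**: the table form (ii) in the two vocabularies. -/
theorem RVTable_iff (p : E → R) (ends : E → Sym2 V) (o a₁ a₂ a₃ b : V) :
    RVTable p ends o a₁ a₂ a₃ b ↔ CaseOne.ZSplitII p ends o a₁ a₂ a₃ b := by
  unfold RVTable CaseOne.ZSplitII
  rw [rvTableExpr_eq_iiExpr]

end Bridge

section Corollaries

variable {V : Type*} {E : Type*} [Fintype E] [DecidableEq E] [Fintype V] [DecidableEq V]
  {R : Type*} [Field R] [LinearOrder R] [IsStrictOrderedRing R]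

/-- p1's (ii) in the pointwise regime `D · P_{G∖W}(o ∈ C(a₂)) ≤ D_o` for every `W ∋ a₃`
(`rvTable_of_regime` transported along `RVTable_iff`). -/
theorem zSplitII_of_regime (p : E → R) (hp : IsProbVec p) (ends : E → Sym2 V) (o a₁ a₂ a₃ b : V)
    (hreg : ∀ W : Set V, a₃ ∈ W →
      prob p (PDEvent ends a₁ a₂ a₃) * delClusterProb p ends a₂ {W : Set V | o ∈ W} W ≤
        CovForm.Do p ends o a₁ a₂ a₃) :
    CaseOne.ZSplitII p ends o a₁ a₂ a₃ b :=
  (RVTable_iff p ends o a₁ a₂ a₃ b).1 (rvTable_of_regime p hp ends o a₁ a₂ a₃ b hreg)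

/-- p1's (RV) in the pointwise regime. -/
theorem caseOneRV_of_regime (p : E → R) (hp : IsProbVec p) (ends : E → Sym2 V) (o a₁ a₂ a₃ b : V)
    (hreg : ∀ W : Set V, a₃ ∈ W →
      prob p (PDEvent ends a₁ a₂ a₃) * delClusterProb p ends a₂ {W : Set V | o ∈ W} W ≤
        CovForm.Do p ends o a₁ a₂ a₃) :
    CaseOne.RV p ends o a₁ a₂ a₃ b :=
  (RV_iff p ends o a₁ a₂ a₃ b).1 (rv_of_regime p hp ends o a₁ a₂ a₃ b hreg)

end Corollaries

end J1RV

end Summit.Ventures.PercRepro2
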